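import Summits.CriticalPhenomena.CardyFormulaZ2.Theorems.CardyComplexConeSLESixFamiliesGiveCardyCollarDomainsPart6
import Mathlib.Analysis.Calculus.InverseFunctionTheorem.ContDiff
import Mathlib.Analysis.Calculus.InverseFunctionTheorem.Deriv
import Mathlib.Analysis.Complex.CauchyIntegral
import Mathlib.Analysis.SpecialFunctions.Complex.Arg
import Literature.Probability.RandomPlanarGeometry.ConformalMapProofs

/-!
# The exterior chart in logarithmic coordinates (helper file 7 for `stub_collarDomains`)

Route `CardyComplexCone`, crux `SLESixFamiliesGiveCardy`, line `collar-touch-sandwich`, STUB E.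
Smooth exterior marks (`IsSmoothMark`) sit on PLATEAUS of the profile, where the outer collar
boundary is, as a set, an analytic arc: the image of a circle arc under the exterior chart.  This file
sets up that chart in logarithmic coordinates,
`Λ T ζ = κ (Φ* (exp ζ))` (`κ = invMapInv z₀`, `Φ*` the exterior Carathéodory chart of the tube data
`T`), on the left half-plane `{re ζ < 0}`:

* `Λ` is holomorphic there with non-vanishing derivative (`differentiableAt_Λ`, `hasDerivAt_Λ`,
  `deriv_Λ_ne_zero`), `C^∞` with continuous derivative (`contDiffAt_Λ`, `continuousAt_deriv_Λ`);
* `Λ (σ + θ i) = tube (2 - e^σ) t` whenever `β* t = e^{iθ}` (`Λ_eq_tube`), and every angle is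
  attained by the boundary correspondence `β*` at a parameter of `[0, 1)` (`exists_β_eq_exp`);
* `Λ` is a local homeomorphism: it maps neighbourhoods onto neighbourhoods (`Λ_map_nhds_eq`).
-/

noncomputable section

open Set Metric Topology Filter Complex
open Literature.Probability.RandomPlanarGeometry

namespace Summit.CriticalPhenomena.CardyFormulaZ2.Cruxes.SLESixFamiliesGiveCardy.CollarTouchSandwich

variable {D : JordanDomain} (T : D.TubeData)

/-- **The exterior chart in logarithmic coordinates** `ζ ↦ κ (Φ* (exp ζ))`. -/
def Λ (ζ : ℂ) : ℂ := invMapInv T.z₀ (T.Ce.Φ (exp ζ))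

/-- The left half-plane `{re ζ < 0}`, where `Λ` is holomorphic. -/
def leftHalf : Set ℂ := {ζ | ζ.re < 0}

/-- The left half-plane is open. -/
theorem isOpen_leftHalf : IsOpen leftHalf := isOpen_lt continuous_re continuous_const

/-- For `re ζ < 0`, `exp ζ` is a nonzero point of the open unit disc. -/
theorem exp_mem_ball {ζ : ℂ} (hζ : ζ ∈ leftHalf) : exp ζ ∈ ball (0 : ℂ) 1 ∧ exp ζ ≠ 0 := by
  refine ⟨mem_ball_zero_iff.2 ?_, exp_ne_zero ζ⟩
  rw [norm_exp]; exact Real.exp_lt_one_iff.2 hζ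

/-- The exterior chart is holomorphic at nonzero… precisely: at every point of the open disc it has the
derivative of the Riemann map, which is nonzero. -/
theorem hasDerivAt_Ce {u : ℂ} (hu : u ∈ ball (0 : ℂ) 1) : HasDerivAt T.Ce.Φ (deriv T.Ce.φ u) u ∧ deriv T.Ce.φ u ≠ 0 := by
  have hUo : IsOpen (ball (0 : ℂ) 1) := isOpen_ball
  have h₁ : HasDerivAt T.Ce.φ (deriv T.Ce.φ u) u :=
    ((T.Ce.φ.differentiableOn u hu).differentiableAt (hUo.mem_nhds hu)).hasDerivAt
  refine ⟨h₁.congr_of_eventuallyEq ?_, ConformalEquiv.deriv_ne_zero_holds T.Ce.φ hUo hu⟩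
  filter_upwards [hUo.mem_nhds hu] with v hv using T.Ce.eqOn hv

/-- The inversion `κ w = z₀ + w⁻¹` has derivative `-(w²)⁻¹` at `w ≠ 0`. -/
theorem hasDerivAt_invMapInv {w : ℂ} (hw : w ≠ 0) : HasDerivAt (invMapInv T.z₀) (-(w ^ 2)⁻¹) w := by
  have : invMapInv T.z₀ = fun y => T.z₀ + y⁻¹ := rfl
  rw [this]
  exact (hasDerivAt_inv hw).const_add T.z₀

/-- **The derivative of `Λ`** at a point of the left half-plane, and its non-vanishing. -/
theorem hasDerivAt_Λ {ζ : ℂ} (hζ : ζ ∈ leftHalf) :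
    HasDerivAt (Λ T) (-((T.Ce.Φ (exp ζ)) ^ 2)⁻¹ * (deriv T.Ce.φ (exp ζ) * exp ζ)) ζ ∧
      -((T.Ce.Φ (exp ζ)) ^ 2)⁻¹ * (deriv T.Ce.φ (exp ζ) * exp ζ) ≠ 0 := by
  obtain ⟨hu, hu0⟩ := exp_mem_ball hζ
  obtain ⟨hΦ, hΦ0⟩ := hasDerivAt_Ce T hu
  have hw : T.Ce.Φ (exp ζ) ≠ 0 := T.Ce_ne_zero (mem_ball_zero_iff.1 hu).le hu0
  refine ⟨?_, mul_ne_zero (neg_ne_zero.2 (inv_ne_zero (pow_ne_zero 2 hw))) (mul_ne_zero hΦ0 hu0)⟩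
  have h1 : HasDerivAt (fun ζ => T.Ce.Φ (exp ζ)) (deriv T.Ce.φ (exp ζ) * exp ζ) ζ := hΦ.comp ζ (hasDerivAt_exp ζ)
  exact (hasDerivAt_invMapInv T hw).comp ζ h1

/-- `Λ` is complex differentiable at every point of the left half-plane. -/
theorem differentiableAt_Λ {ζ : ℂ} (hζ : ζ ∈ leftHalf) : DifferentiableAt ℂ (Λ T) ζ :=
  (hasDerivAt_Λ T hζ).1.differentiableAt

/-- The derivative of `Λ` does not vanish on the left half-plane. -/
theorem deriv_Λ_ne_zero {ζ : ℂ} (hζ : ζ ∈ leftHalf) : deriv (Λ T) ζ ≠ 0 := by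
  rw [(hasDerivAt_Λ T hζ).1.deriv]; exact (hasDerivAt_Λ T hζ).2

/-- `Λ` is `C^∞` (indeed analytic) on the left half-plane. -/
theorem contDiffOn_Λ : ContDiffOn ℂ ⊤ (Λ T) leftHalf :=
  (show DifferentiableOn ℂ (Λ T) leftHalf from fun _ hζ => (differentiableAt_Λ T hζ).differentiableWithinAt).contDiffOn
    isOpen_leftHalf

/-- `Λ` is `C^∞` at every point of the left half-plane. -/
theorem contDiffAt_Λ {ζ : ℂ} (hζ : ζ ∈ leftHalf) {n : WithTop ℕ∞} : ContDiffAt ℂ n (Λ T) ζ :=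
  ((contDiffOn_Λ T).contDiffAt (isOpen_leftHalf.mem_nhds hζ)).of_le le_top

/-- The derivative of `Λ` is `C^∞` on the left half-plane. -/
theorem contDiffOn_deriv_Λ : ContDiffOn ℂ ⊤ (deriv (Λ T)) leftHalf := by
  have h := contDiffOn_Λ T
  rw [show (⊤ : WithTop ℕ∞) = ⊤ + 1 from rfl, contDiffOn_succ_iff_deriv_of_isOpen isOpen_leftHalf] at h
  exact h.2.2

/-- The derivative of `Λ` is continuous at every point of the left half-plane. -/
theorem continuousAt_deriv_Λ {ζ : ℂ} (hζ : ζ ∈ leftHalf) : ContinuousAt (deriv (Λ T)) ζ :=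
  ((contDiffOn_deriv_Λ T).continuousOn.continuousWithinAt hζ).continuousAt (isOpen_leftHalf.mem_nhds hζ)

/-- `Λ` has a strict derivative at every point of the left half-plane. -/
theorem hasStrictDerivAt_Λ {ζ : ℂ} (hζ : ζ ∈ leftHalf) : HasStrictDerivAt (Λ T) (deriv (Λ T) ζ) ζ :=
  (contDiffAt_Λ T hζ (n := ⊤)).hasStrictDerivAt (by simp)

/-- **`Λ` is a local homeomorphism**: it maps the neighbourhood filter of `ζ` onto that of `Λ ζ`. -/
theorem Λ_map_nhds_eq {ζ : ℂ} (hζ : ζ ∈ leftHalf) : map (Λ T) (𝓝 ζ) = 𝓝 (Λ T ζ) :=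
  (hasStrictDerivAt_Λ T hζ).map_nhds_eq (deriv_Λ_ne_zero T hζ)

/-! ### `Λ` and the tube -/

/-- **`Λ` in tube coordinates**: `Λ (σ + θ i) = tube (2 - e^σ) t` whenever `β* t = e^{iθ}`, for
`σ < 0`. -/
theorem Λ_eq_tube {ζ : ℂ} (hζ : ζ ∈ leftHalf) {t : ℝ} (ht : T.Ce.β t = exp (ζ.im * I)) :
    Λ T ζ = T.tube (2 - Real.exp ζ.re) t := by
  have hlt : Real.exp ζ.re < 1 := Real.exp_lt_one_iff.2 hζ
  rw [T.tube_of_one_lt (by linarith), Λ]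
  congr 2
  rw [show (2 - (2 - Real.exp ζ.re) : ℝ) = Real.exp ζ.re by ring, ht, Complex.ofReal_exp, ← exp_add, re_add_im]

/-- The level of the tube point `Λ ζ`: `2 - e^{re ζ} ∈ (1, 2)` for `re ζ < 0`. -/
theorem level_mem {ζ : ℂ} (hζ : ζ ∈ leftHalf) : 1 < 2 - Real.exp ζ.re ∧ 2 - Real.exp ζ.re < 2 := by
  have := Real.exp_lt_one_iff.2 hζ; have := Real.exp_pos ζ.re
  constructor <;> linarith

/-- **Every angle is attained by the exterior boundary correspondence** at a parameter of `[0, 1)`. -/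
theorem exists_β_eq_exp (θ : ℝ) : ∃ t ∈ Ico (0 : ℝ) 1, T.Ce.β t = exp (θ * I) := by
  have hv1 : ‖exp (θ * I)‖ = 1 := norm_exp_ofReal_mul_I θ
  obtain ⟨t₁, ht₁⟩ : ∃ t, T.Ce.β t = exp (θ * I) := by
    have hfr : T.Ce.Φ (exp (θ * I)) ∈ frontier (D.inverted T.hz₀).carrier := T.Ce.apply_mem_frontier hv1
    rw [← (D.inverted T.hz₀).range_boundary] at hfr
    obtain ⟨t, ht⟩ := hfr
    refine ⟨t, ?_⟩
    have h1 : T.Ce.Φ (T.Ce.β t) = T.Ce.Φ (exp (θ * I)) := by rw [T.Ce.apply_β]; exact ht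
    exact T.Ce.injOn (mem_closedBall_zero_iff.2 (T.Ce.norm_β t).le) (mem_closedBall_zero_iff.2 hv1.le) h1
  refine ⟨Int.fract t₁, ⟨Int.fract_nonneg _, Int.fract_lt_one _⟩, ?_⟩
  rw [← ht₁]; exact apply_fract_of_periodic T.Ce.periodic_β t₁

/-- The angle of a boundary parameter: `β* t = e^{i arg (β* t)}`. -/
theorem β_eq_exp_arg (t : ℝ) : T.Ce.β t = exp ((arg (T.Ce.β t) : ℂ) * I) := by
  have := norm_mul_exp_arg_mul_I (T.Ce.β t)
  rw [T.Ce.norm_β t, Complex.ofReal_one, one_mul] at this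
  exact this.symm

/-- **The plateau point in logarithmic coordinates**: for a level `1 < s < 2` and a parameter `t`,
`tube s t = Λ (log (2 - s) + arg (β* t) i)`. -/
theorem tube_eq_Λ {s : ℝ} (hs1 : 1 < s) (hs2 : s < 2) (t : ℝ) :
    T.tube s t = Λ T ((Real.log (2 - s) : ℂ) + (arg (T.Ce.β t) : ℂ) * I) := by
  have hre : ((Real.log (2 - s) : ℂ) + (arg (T.Ce.β t) : ℂ) * I).re = Real.log (2 - s) := by
    simp [Complex.add_re, Complex.ofReal_re, Complex.mul_re, Complex.I_re, Complex.I_im, Complex.ofReal_im]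
  have him : ((Real.log (2 - s) : ℂ) + (arg (T.Ce.β t) : ℂ) * I).im = arg (T.Ce.β t) := by
    simp [Complex.add_im, Complex.ofReal_im, Complex.mul_im, Complex.I_re, Complex.I_im, Complex.ofReal_re]
  have hζ : ((Real.log (2 - s) : ℂ) + (arg (T.Ce.β t) : ℂ) * I) ∈ leftHalf := by
    show Complex.re _ < 0; rw [hre]; exact Real.log_neg (by linarith) (by linarith)
  rw [Λ_eq_tube T hζ (t := t) (by rw [him]; exact β_eq_exp_arg T t), hre, Real.exp_log (by linarith)]
  congr 1; ring

end Summit.CriticalPhenomena.CardyFormulaZ2.Cruxes.SLESixFamiliesGiveCardy.CollarTouchSandwich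

end

/-!
# The collar domain near a plateau point, in logarithmic coordinates (helper file 8 for `stub_collarDomains`)

Route `CardyComplexCone`, crux `SLESixFamiliesGiveCardy`, line `collar-touch-sandwich`, STUB E.
For a profile `P` of width `h ≤ 1/4` with a PLATEAU `p = 1 + h` around a parameter `t⋆ ∈ [0, 1)`
(modulo `1`, half-width `λ`), the plateau point `M = tube (1 + h) t⋆` is `Λ ζ⋆` with
`ζ⋆ = log (1 - h) + i arg (β* t⋆)`, and NEAR `ζ⋆` the profile collar domain is a half-plane in
logarithmic coordinates: `Λ ζ ∈ collar ↔ log (1 - h) < re ζ` (`mem_profileDomain_iff_re`; by the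
parameter-closeness lemma `exists_param_close_of_dist_lt` of `CollarULC.lean`, nearby tube points have
parameters on the plateau).  Plus the modulo-one bookkeeping transferring a plateau stated on the real
line to the form used here (`plateau_of_abs_lt`, `exists_int_abs_lt`).
-/

noncomputable section

open Set Metric Topology Filter Complex
open Literature.Probability.RandomPlanarGeometry

namespace Summit.CriticalPhenomena.CardyFormulaZ2.Cruxes.SLESixFamiliesGiveCardy.CollarTouchSandwich

/-! ### Modulo-one bookkeeping -/

/-- Two parameters of `[0, 1]` that are close modulo one differ, up to an integer, by less than `λ`. -/
theorem exists_int_abs_lt {a u lam : ℝ} (ha : a ∈ Icc (0 : ℝ) 1) (hu : u ∈ Icc (0 : ℝ) 1)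
    (h : |a - u| < lam ∨ 1 - lam < |a - u|) : ∃ n : ℤ, |a + n - u| < lam := by
  rcases h with h | h
  · exact ⟨0, by simpa using h⟩
  · rcases le_or_gt u a with hua | hua
    · rw [abs_of_nonneg (by linarith)] at h
      refine ⟨-1, ?_⟩; push_cast; rw [abs_lt]; constructor <;> linarith [ha.2, hu.1]
    · rw [abs_of_neg (by linarith)] at h
      refine ⟨1, ?_⟩; push_cast; rw [abs_lt]; constructor <;> linarith [ha.1, hu.2]

/-- **Plateau transfer**: a plateau `p = c` on the real interval `(t₀ - λ₀, t₀ + λ₀)` gives, for a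
`1`-periodic `p` and a representative `a ∈ [0, 1)` congruent to a point `a + n` within `λ₀ / 2` of `t₀`,
the modulo-one plateau around `a` of half-width `λ₀ / 2` on `[0, 1]`. -/
theorem plateau_of_abs_lt {p : ℝ → ℝ} (hper : Function.Periodic p 1) {c t₀ lam₀ a : ℝ} {n : ℤ}
    (hpl : ∀ t, |t - t₀| < lam₀ → p t = c) (ha : a ∈ Icc (0 : ℝ) 1) (hn : |a + n - t₀| < lam₀ / 2) :
    ∀ t ∈ Icc (0 : ℝ) 1, (|t - a| < lam₀ / 2 ∨ 1 - lam₀ / 2 < |t - a|) → p t = c := by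
  intro t ht h
  have key : ∀ m : ℤ, |t + m + n - t₀| < lam₀ → p t = c := fun m hm => by
    have := hpl (t + m + n) hm
    rwa [show t + m + n = t + ((m + n : ℤ) : ℝ) * 1 by push_cast; ring, hper.int_mul] at this
  have hn' := abs_lt.1 hn
  rcases h with h | h
  · have h' := abs_lt.1 h
    exact key 0 (by push_cast; rw [abs_lt]; constructor <;> linarith)
  · rcases le_or_gt a t with hat | hat
    · rw [abs_of_nonneg (by linarith)] at h
      exact key (-1) (by push_cast; rw [abs_lt]; constructor <;> linarith [ht.2, ha.1])
    · rw [abs_of_neg (by linarith)] at h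
      exact key 1 (by push_cast; rw [abs_lt]; constructor <;> linarith [ht.1, ha.2])

/-! ### The collar domain near a plateau point -/

variable {R : ConformalRectangle} (T : R.toJordanDomain.TubeData) (P : Profile)

/-- The logarithmic level `σ₀ = log (1 - h)` of the plateau `p = 1 + h`. -/
def σ₀ : ℝ := Real.log (1 - P.h)

/-- The plateau point `tube (1 + h) t` in logarithmic coordinates: `ζ = σ₀ + i arg (β* t)`. -/
def ζpt (t : ℝ) : ℂ := (σ₀ P : ℂ) + (arg (T.Ce.β t) : ℂ) * I

/-- The real part of the plateau coordinate. -/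
@[simp] theorem ζpt_re (t : ℝ) : (ζpt T P t).re = σ₀ P := by
  simp [ζpt]

/-- The imaginary part of the plateau coordinate. -/
@[simp] theorem ζpt_im (t : ℝ) : (ζpt T P t).im = arg (T.Ce.β t) := by
  simp [ζpt]

/-- `σ₀ < 0`. -/
theorem σ₀_neg : σ₀ P < 0 := Real.log_neg (by linarith [P.le_half]) (by linarith [P.pos])

/-- `exp σ₀ = 1 - h`. -/
theorem exp_σ₀ : Real.exp (σ₀ P) = 1 - P.h := Real.exp_log (by linarith [P.le_half])

/-- The plateau coordinate lies in the left half-plane. -/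
theorem ζpt_mem (t : ℝ) : ζpt T P t ∈ leftHalf := by
  show Complex.re _ < 0; rw [ζpt_re]; exact σ₀_neg P

/-- **The plateau point is `Λ ζ`**: `tube (1 + h) t = Λ (ζpt t)`. -/
theorem tube_eq_Λ_ζpt (t : ℝ) : T.tube (1 + P.h) t = Λ T (ζpt T P t) := by
  rw [tube_eq_Λ T (by linarith [P.pos]) (by linarith [P.le_half]) t, ζpt, σ₀, show (2 - (1 + P.h) : ℝ) = 1 - P.h by ring]

/-- A logarithmic coordinate of the plateau point `tube (1 + h) t`: real part `σ₀`, imaginary part an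
argument of `β* t`; then `Λ ζ = tube (1 + h) t`. -/
theorem Λ_eq_tube_plateau {ζs : ℂ} (hζre : ζs.re = σ₀ P) {t : ℝ} (hζim : T.Ce.β t = exp (ζs.im * I)) :
    Λ T ζs = T.tube (1 + P.h) t := by
  have hζ : ζs ∈ leftHalf := by show ζs.re < 0; rw [hζre]; exact σ₀_neg P
  rw [Λ_eq_tube T hζ hζim, hζre, exp_σ₀]; congr 1; ring

variable (hclose : ∀ t, dist (profileLoop T P.p t) (R.boundary t) < infDist T.z₀ (frontier R.carrier))
  (hP4 : P.h ≤ 1 / 4) {tst lam : ℝ} (htst : tst ∈ Ico (0 : ℝ) 1) (hlam : 0 < lam) (hlam1 : lam ≤ 1 / 2)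
  (hpl : ∀ t ∈ Icc (0 : ℝ) 1, (|t - tst| < lam ∨ 1 - lam < |t - tst|) → P.p t = 1 + P.h)
  {ζs : ℂ} (hζre : ζs.re = σ₀ P) (hζim : T.Ce.β tst = exp (ζs.im * I))
include hclose hP4 htst hlam hlam1 hpl hζre hζim

/-- **The collar domain is a half-plane in logarithmic coordinates near a plateau point**: if
`re ζ⋆ = σ₀` and `β* t⋆ = e^{i im ζ⋆}` for a plateau parameter `t⋆`, there is `ρ > 0` such that for
`dist ζ ζ⋆ < ρ`, `ζ ∈ leftHalf` and `Λ ζ ∈ collar ↔ σ₀ < re ζ`. -/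
theorem mem_profileDomain_iff_re : ∃ ρ > 0, ∀ ζ, dist ζ ζs < ρ →
    ζ ∈ leftHalf ∧ (Λ T ζ ∈ (profileDomain T P).carrier ↔ σ₀ P < ζ.re) := by
  have hh := P.pos
  have hζsL : ζs ∈ leftHalf := by show ζs.re < 0; rw [hζre]; exact σ₀_neg P
  obtain ⟨η₁, hη₁, hparam⟩ := MarkedDomain.exists_param_close_of_dist_lt R T hlam hlam1
  -- continuity of `Λ` at the plateau coordinate
  have hcont : ContinuousAt (Λ T) ζs := (differentiableAt_Λ T hζsL).continuousAt
  obtain ⟨ρ₁, hρ₁, hΛ⟩ := Metric.continuousAt_iff.1 hcont η₁ hη₁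
  -- continuity of `exp` at `σ₀`
  obtain ⟨ρ₂, hρ₂, hexp⟩ := Metric.continuousAt_iff.1 (Real.continuous_exp.continuousAt (x := σ₀ P)) (min P.h (1 / 4))
    (lt_min hh (by norm_num))
  refine ⟨min ρ₁ ρ₂, lt_min hρ₁ hρ₂, fun ζ hζ => ?_⟩
  have hζ₁ : dist ζ ζs < ρ₁ := hζ.trans_le (min_le_left _ _)
  have hζ₂ : dist ζ ζs < ρ₂ := hζ.trans_le (min_le_right _ _)
  -- the level `s = 2 - e^{re ζ}` is in `(1, 3/2)`
  have hre : dist ζ.re (σ₀ P) < ρ₂ := by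
    rw [← hζre]; exact (abs_re_le_norm (ζ - ζs)).trans_lt (by rwa [← dist_eq_norm])
  have hex := hexp hre
  rw [Real.dist_eq, exp_σ₀, abs_lt] at hex
  have hex1 : Real.exp ζ.re < 1 := by linarith [hex.2, min_le_left P.h (1 / 4)]
  have hex2 : 1 / 2 < Real.exp ζ.re := by linarith [hex.1, min_le_right P.h (1 / 4)]
  have hζL : ζ ∈ leftHalf := by
    show ζ.re < 0; exact Real.exp_lt_one_iff.1 (by simpa using hex1)
  refine ⟨hζL, ?_⟩
  -- tube coordinates of `Λ ζ`
  obtain ⟨t, ht, hβ⟩ := exists_β_eq_exp T ζ.im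
  have hΛζ : Λ T ζ = T.tube (2 - Real.exp ζ.re) t := Λ_eq_tube T hζL hβ
  set s := 2 - Real.exp ζ.re with hs
  -- the parameter `t` lies on the plateau
  have hM : Λ T ζs = T.tube (1 + P.h) tst := Λ_eq_tube_plateau T P hζre hζim
  have hd : dist (T.tube s t) (T.tube (1 + P.h) tst) < η₁ := by
    rw [← hΛζ, ← hM]; exact hΛ hζ₁
  have hpt : P.p t = 1 + P.h := hpl t ⟨ht.1, ht.2.le⟩
    (hparam s t (1 + P.h) tst ⟨by linarith, by linarith⟩ ⟨by linarith, by linarith⟩ ⟨ht.1, ht.2.le⟩ ⟨htst.1, htst.2.le⟩ hd)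
  rw [hΛζ]
  constructor
  · intro hmem
    by_contra hle
    push Not at hle
    have hsle : P.p t ≤ s := by
      rw [hpt, hs]
      have : Real.exp ζ.re ≤ Real.exp (σ₀ P) := Real.exp_le_exp.2 hle
      rw [exp_σ₀] at this; linarith
    rcases hsle.eq_or_lt with he | hlt
    · have hfr : T.tube s t ∈ frontier (profileDomain T P).carrier := by
        rw [frontier_profileDomain, ← he]; exact ⟨t, rfl⟩
      exact Set.disjoint_left.1 (profileDomain T P).disjoint_carrier_frontier hmem hfr
    · exact tube_not_mem_profileDomain T P hlt (by linarith) hmem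
  · intro hlt
    refine tube_mem_profileDomain T P hclose (by linarith) ?_
    rw [hpt, hs]
    have : Real.exp (σ₀ P) < Real.exp ζ.re := Real.exp_lt_exp.2 hlt
    rw [exp_σ₀] at this; linarith

omit hclose hP4 hlam1 in
/-- The plateau point is a boundary point of the collar domain: `Λ ζ⋆ = loop (t⋆)`. -/
theorem Λ_eq_profileLoop_plateau : Λ T ζs = profileLoop T P.p tst := by
  rw [Λ_eq_tube_plateau T P hζre hζim, profileLoop, hpl tst ⟨htst.1, htst.2.le⟩ (Or.inl (by simpa using hlam))]

omit T P hclose hP4 htst hlam hlam1 hpl hζre hζim in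
/-- **Main statement of this file** (registered helper stub, arrow style): near a plateau point the
collar domain is a half-plane in logarithmic coordinates. -/
theorem logChart_halfPlane : ∀ {R : ConformalRectangle} (T : R.toJordanDomain.TubeData) (P : Profile), (∀ t, dist (profileLoop T P.p t) (R.boundary t) < infDist T.z₀ (frontier R.carrier)) → P.h ≤ 1 / 4 → ∀ {tst lam : ℝ}, tst ∈ Ico (0 : ℝ) 1 → 0 < lam → lam ≤ 1 / 2 → (∀ t ∈ Icc (0 : ℝ) 1, (|t - tst| < lam ∨ 1 - lam < |t - tst|) → P.p t = 1 + P.h) → ∀ {ζs : ℂ}, ζs.re = σ₀ P → T.Ce.β tst = exp (ζs.im * I) → ∃ ρ > 0, ∀ ζ, dist ζ ζs < ρ → ζ ∈ leftHalf ∧ (Λ T ζ ∈ (profileDomain T P).carrier ↔ σ₀ P < ζ.re) :=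
  fun T P hclose hP4 _ _ htst hlam hlam1 hpl _ hζre hζim => mem_profileDomain_iff_re T P hclose hP4 htst hlam hlam1 hpl hζre hζim

end Summit.CriticalPhenomena.CardyFormulaZ2.Cruxes.SLESixFamiliesGiveCardy.CollarTouchSandwich

end
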